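import Summits.BirchSwinnertonDyer.Rank1Residual.O5.O5KummerLine
import Mathlib.NumberTheory.NumberField.Discriminant.Defs
import HarnessLib

/-!
# O5 — P-K10: the TORSOR-DISCRIMINANT law at the tame `e = 4` prime `3` (`d3 ∈ {9, 15}` reads the Kodaira
# symbol III* / III of every O5b curve off the Kummer nine-point torsor), typed as an EVIDENCE node with
# its census record (cell `b2b-bsdres`, lane CLASS-CLOSURE, class O5, seat cc-typer-5 GEN 7 = O5/O6 typer
# of record; content = o5-r1 GEN 5 pre-registration `gen5/KUM3LOC-PREREG.md` Addenda 8–9 (699affd6be04d279),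
# `gen5/T19-PROOF-SKETCH.md` §7 (8408ecf2b80ea64d), harvest-2 E88 §6.3 (iii) / §7 (dd2e75e9c5f73320); asked by
# o5-r1 (INBOX 2026-08-21T15:45Z) and ruled by cc-lead ⟦gen23⟧ (8)(c) "the P-K10 torsor-discriminant law lands
# as a computational EVIDENCE record") — TYPED, EVIDENCE-LABELLED, NOTHING ASSERTED; 0 Literature facts

HONEST FRAMING (cell `b2b-bsdres`, run/shared/lean/b2b/bsd-rank1-residual/, verbatim in every file):
the goal of the cell is to DELETE the COMBINATION-SHAPED residual classes of the Birch–Swinnerton-Dyer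
formula for ALL analytic-rank `≤ 1` elliptic curves over `ℚ` — "full BSD formula for every rank `≤ 1`
curve in class `C`" assembled STRICTLY from published theorems — so that the rank-`≤ 1` remainder
becomes exactly the CONSTRUCTION-SHAPED classes, which are TYPED (missing-input `Prop`s), NOT
attempted. This is not "finishing BSD". Lane CLASS-CLOSURE (`CLASS-CLOSURE-PLAN.md` §3.5 O5,
experiment type (4): per-curve certificates as INSTRUMENTATION): research routes; no claim beyond the
stated classes; census output is EVIDENCE, never a Literature fact; nothing is booked; no mark of
`RESIDUAL-MAP.md` moves; no `L`-value, Selmer group or main conjecture enters the instrument (division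
polynomials and `3`-adic field arithmetic only).

## What (o5-r1 GEN 5, KUM3LOC Addendum 8 — PRE-REGISTERED 2026-08-21T15:36Z BEFORE kit j134568 — and
## Addendum 9, the replication at scale kit j134597; instrument `kum3loc/job/lib_k10.gp` 98d35f92af543c59)

For an O5b curve `W` (additive, tame `e = 4` at `3`: Kodaira III, `v₃Δ_min = 3`, or III*, `v₃Δ_min = 9`)
take the census Kummer base point `P = (x, y)` (`x ∈ ℚ`, `P ∈ W(ℚ₃) ∖ 3W(ℚ₃)` not `2`-torsion, KUM3LOC `addx`),
its nine-point polynomial `Λ_x = Φ₃ − x·Ψ₃² ∈ ℚ[X]` (roots = the abscissae of `[3]⁻¹P`; `O5KummerLine` §0) and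
**`d3 := v₃(disc(ℚ₃[X]/Λ_x))`** = the `3`-adic valuation of the discriminant of the nonic number field
`ℚ[X]/(Λ_x)` (PARI `nfdisc([U,[3]])`; defined when `Λ_x` is irreducible over `ℚ`).  By the T19 proof
(`O5KummerLine.KummerLineUniversalThree`, docstring) `d3 = 8 + s`, `s` = the `L`-upper ramification break
of the torsor field `M_c/L`, `L = ℚ₉(3^{1/8})` (E88 §6.3 (iii): disc of the nonic field = Artin conductor of
`𝟙 ⊕ W₈`, `f(W₈) = 8·1 + 8·(s/8)`): `V₀`-classes give `d3 ∈ {9 (ℓ*, s = 1), 19 (generic, s = 11)}`,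
`V₀⊗ω`-classes `d3 ∈ {13 (s = 5), 15 (s = 7)}`.
PREDICTIONS frozen before j134568 (500 rows): good-ss `9` (100/100), III*-LocIrr `9` (150/150; `19` on any row
would have REFUTED the proof sketch), III-LocIrr `∈ {13, 15}` (which one NOT predicted), reducible explorers:
none.  OBSERVED (j134568, 0 errors): exactly as predicted, III-LocIrr uniformly `15`, explorers III* `9` /
III `15`.  REPLICATION (j134597, all 154 830 O5b singles `9 ∥ N < 5·10⁵`, 84 s, rows
`kum3loc/outputs/k10full_rows.txt` 9922a189fcd14531, score `K10full-SCORE.txt` e88aea3a129ae34f):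
**III* `d3 = 9` on 77 395/77 395 computed (LocIrr 24 526 with `(e,f) = (9,1)`; local class 12: 27 224,
`(3,3)`; class 11: 25 645, `(3,1)+(3,2)`; 20 rows `e_IRREDPOL` = `Λ_x` reducible over `ℚ`, instrument
limitation), III `d3 = 15` on 77 415/77 415 (`(9,1)` throughout); 0 violations on 154 810 computed rows;
`19` and `13` never occur.**  Second code path: harvest-2 kit j134954 (`gen41/src/e88_d3check.gp`, own GP,
13/13 incl. hand-made curves) — same engine family (PARI), NOT a second engine (OWNERS §0 item 4): ONE-ENGINE
EVIDENCE, PROVISIONAL label for any consumer.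

## What is typed
* `kummerNinePolyRat W x : ℚ[X]` (the rational model of `O5KummerLine.kummerNinePolyThree`, PROVED to map to
  it under `ℚ → ℚ₃`), `torsorDiscExpThree W x := v₃(discr(ℚ[X]/Λ_x))` over Mathlib's `NumberField.discr` of
  `AdjoinRoot Λ_x` (a number field under `Fact (Irreducible Λ_x)`).
* **`@[conjecture] TorsorDiscriminantLawThree`** — the law as pre-registered and observed: for `W ∈ O5b`
  and a Kummer base point with rational abscissa and `Λ_x` irreducible over `ℚ`, `d3 = 9` if `v₃Δ = 9`
  (III*) and `d3 = 15` otherwise (III).  GRADE: the III*-LocIrr part is a COROLLARY of the written T19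
  proof (THEOREM-CANDIDATE); the III*-reducible part (Kummer line = the canonical-subgroup line, T18) and
  the III part ("always a generic `s = 7` line of `H¹(ℚ₃, V₀⊗ω)`, never the `s = 5` line") are
  CENSUS-MINED (no prediction was registered for them) — hence ONE `@[conjecture]` node (lane rule ⟦gen22⟧
  (8)(b)); falsifier: one O5b row with `d3 ∉ {9, 15}` or with the wrong member.  Held-out status: the
  III*-LocIrr / good-ss values were PREDICTED before the pilot; the other strata are post-hoc readings of
  the same frozen instrument — a conjecture item is never promoted above EVIDENCE by a count.
* `torsorDiscCensusK10` — the six-stratum score table of j134597 as kernel data with `decide`d totals.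

References: J.-M. Fontaine, Invent. Math. 81 (1985) Thm A [Fontaine1985] (via [Yoshida2009, p. 3],
[Hattori2008, p. 3]); J.-P. Serre, *Corps locaux* IV §3, XV §2 [Serre1979]; o5-r1 GEN 5 / harvest-2 E88 (cell
EVIDENCE / DERIVATION); `cells/o5o6/TARGETS.md` §O5 GEN 5; `class-closure/O5/TYPED.md` §11.

## AMENDMENT (cc-typer-5 GEN 8, 2026-08-21; ask A-O5-18 (b), o5-r1 GEN 6 `HOME/INBOX.md` 16:46Z) — APPEND-ONLY:
## §§1–3 byte-identical; new §4 = the I₀*-ss clause `d3 = 13` (P-K11 arm A) and the break table of v2 Thm 3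

o5-r1 GEN 6 (`gen6/T19-PROOF-v2.md` 4096abf768197445, Thm 3; pre-registration `gen6/P-K11-PREREG.md` §0–§3 sha16
865ebe3113ad7574 frozen BEFORE kit j135074) extended the torsor-discriminant calculus to the TWISTED class
`V₁ = V₀ ⊗ ω`: for a Kummer base point of formal valuation `t` on the good model over `K = ℚ₃(3^{1/4})` the torsor
field has the single upper break `s = 9 − 8t` over `L = ℚ₉(3^{1/8})` and the nonic stem field has `d3 = s + 8` —
good-ss `t = 1 ↦ (s, d3) = (1, 9)`; III `t = 1/4 ↦ (7, 15)`; **I₀*-ss `t = 1/2 ↦ (5, 13)`** (the conductor-5 line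
`ℓ₅*`; never run before P-K11 and PREDICTED); III* `t = 3/4 ↦ s = 3 <` the flat bound, read on `ℓ₁*` instead
(`d3 = 9`, T19).  P-K11 (kit j135074, 771 tasks, 14 346 rows, 0 errors; frozen scorer `k11_score.py` be23d1ff):
**arm A — `d3 = 13`, `(e,f) = (9,1)` on ALL 9 744 census I₀*-ss rows (O5a₀ `a₃(untwist) = 0`: 5 906 / 5 906; O5a±
`a₃ = ±3`: 3 838 / 3 838); arms C0r / C0x — `d3 = 13` on 500 + 250 RANDOM local I₀*-ss curves; 0 counter-verdicts.**
Independent check of the derivation: harvest-2 GEN 42, E90 (`gen42/E90-T19v2-check.md` 6aa1eb9937515da2): R6 (Thm 3)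
✓, with second-seat numerics kit j135711 (harvest-2's own GP code path: six I₀*-ss curves ↦ `(e,f) = (9,1)`,
`d3 = 13`; controls good-ss ↦ 9 ×3, III ↦ 15, III* ↦ 9; the reducible I₀* control has no rootless `Λ`, as it must)
— same engine family (PARI), so the two-engine rule still labels the numbers ONE-ENGINE EVIDENCE, PROVISIONAL.
§4 types: `@[conjecture] TorsorDiscriminantLawIzeroStarThree` (the I₀*-ss clause as its own node — the P-K10 node
`TorsorDiscriminantLawThree` is UNCHANGED: its domain `ClassO5 ∧ SubTprime` = O5b does not meet `SubGss` = O5a),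
the break-table arithmetic `torsorBreakThree` / `torsorBreakThree_table` (PROVED, `norm_num`), and the record
`torsorDiscCensusK11` with `decide`d totals.  Companion typed nodes (same ask, part (a)): T20 / T21 / T22 in
`O5/O5KummerLineTwisted.lean`.  0 Literature facts; net debt 0; nothing booked; no mark of `RESIDUAL-MAP.md` moves.
-/

set_option autoImplicit false

noncomputable section

open scoped Classical

open Polynomial WeierstrassCurve Literature.NumberTheory.EllipticCurves
  Summit.BirchSwinnertonDyer.Rank1Residual.Additive

namespace Summit.BirchSwinnertonDyer.Rank1Residual.O5

/-! ## §1 Vocabulary: the rational nine-polynomial and the torsor discriminant exponent -/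

/-- The **rational Kummer nine-polynomial** `Λ_x := Φ₃ − x·Ψ₃² ∈ ℚ[X]` of `W` at a rational abscissa `x`
(the census object: `x(P) ∈ ℚ` for the KUM3LOC base point). [folklore] -/
def kummerNinePolyRat (W : WeierstrassCurve ℚ) (x : ℚ) : ℚ[X] := W.Φ 3 - C x * W.Ψ₃ ^ 2

/-- The rational nine-polynomial base-changes to `O5KummerLine.kummerNinePolyThree` over `ℚ₃`. [folklore] -/
theorem kummerNinePolyRat_map (W : WeierstrassCurve ℚ) (x : ℚ) :
    (kummerNinePolyRat W x).map (algebraMap ℚ ℚ_[3]) = kummerNinePolyThree W (x : ℚ_[3]) := by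
  unfold kummerNinePolyRat kummerNinePolyThree
  rw [Polynomial.map_sub, Polynomial.map_mul, Polynomial.map_pow, map_C, ← map_Ψ₃, ← map_Φ]
  rfl

/-- **`d3(W, x)`** — the `3`-adic valuation of the discriminant of the nonic number field `ℚ[X]/(Λ_x)`
(`= v₃ disc(ℚ₃[X]/Λ_x)`, the sum of the local discriminant exponents above `3`; PARI `nfdisc([U,[3]])`).
Meaningful when `Λ_x` is irreducible over `ℚ` (instance argument). [folklore] -/
def torsorDiscExpThree (W : WeierstrassCurve ℚ) (x : ℚ) [Fact (Irreducible (kummerNinePolyRat W x))] : ℕ :=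
  padicValInt 3 (NumberField.discr (AdjoinRoot (kummerNinePolyRat W x)))

/-! ## §2 The law (EVIDENCE node; `@[conjecture]` until a kernel proof) -/

/-- **P-K10 `TorsorDiscriminantLawThree` (o5-r1 GEN 5, pre-registered KUM3LOC Addendum 8; EVIDENCE
0 violations / 154 810; the III*-LocIrr clause is a COROLLARY of the written T19 proof, the rest is
census-mined).**  For an O5b curve `W` (`ClassO5 ∧ SubTprime` at `3`: Kodaira III / III*, tame `e = 4`),
a Kummer base point `(x, y)` with `x ∈ ℚ` (`O5KummerLine.IsKummerBasePointThree`: on the curve, not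
`2`-torsion, `Λ_x` rootless over `ℚ₃`) and `Λ_x` irreducible over `ℚ`: the torsor discriminant exponent is
`d3 = 9` when `v₃(Δ_min) = 9` (III*: the distinguished line `ℓ*`, `s = 1`, for `LocIrr` rows by Fontaine's
bound — T19; `(e,f) = (3,3)` / `(3,1)+(3,2)` with total `9` on the reducible-local classes 12 / 11, T18's
canonical-subgroup line) and `d3 = 15` when `v₃(Δ_min) = 3` (III: a generic `s = 7` line of
`H¹(ℚ₃, V₀ ⊗ ω)` on LocIrr rows — Fontaine gives no constraint there, E88 §5 (c) —, and `15` again on the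
reducible-local classes 01 / 02).  Why it might fail: only on the census-mined strata (a III curve realising
the `s = 5` line, `d3 = 13`; a reducible III* row with another splitting type); the III*-LocIrr value `9` is
forced by the T19 proof.  Instrument: ONE engine family (PARI `nfdisc`; second code path harvest-2 j134954
13/13) — PROVISIONAL for consumers under the two-engine rule.
[evidence: census cell O5, o5-r1 GEN 5 P-K10: kit j134568 500/500 as pre-registered; kit j134597 154 810/154 810 (III* 9: 24 526 + 27 224 + 25 645; III 15: 77 415), 0 violations, 20 e_IRREDPOL]
[cite: Fontaine1985, Thm. A] [cite: Yoshida2009, p. 3] [cite: Serre1979, Ch. IV §3 and Ch. XV §2] -/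
@[conjecture] def TorsorDiscriminantLawThree : Prop :=
  ∀ (W : WeierstrassCurve ℚ) [W.IsElliptic] [W.IsGloballyMinimal], ClassO5 W 3 → SubTprime W 3 →
    ∀ (x : ℚ) (y : ℚ_[3]), IsKummerBasePointThree W (x : ℚ_[3]) y →
      ∀ [Fact (Irreducible (kummerNinePolyRat W x))],
        torsorDiscExpThree W x = if padicValRat 3 W.Δ = 9 then 9 else 15

/-- Reading of the law on a III* row (`v₃Δ = 9`): `d3 = 9`. [folklore] -/
theorem torsorDiscExpThree_eq_nine_of_law (h : TorsorDiscriminantLawThree)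
    (W : WeierstrassCurve ℚ) [W.IsElliptic] [W.IsGloballyMinimal] (hO5 : ClassO5 W 3) (ht : SubTprime W 3)
    (x : ℚ) (y : ℚ_[3]) (hP : IsKummerBasePointThree W (x : ℚ_[3]) y)
    [Fact (Irreducible (kummerNinePolyRat W x))] (hΔ : padicValRat 3 W.Δ = 9) :
    torsorDiscExpThree W x = 9 := by
  have := h W hO5 ht x y hP
  rwa [if_pos hΔ] at this

/-- Reading of the law on a III row (`v₃Δ ≠ 9`, i.e. `= 3` on O5b): `d3 = 15`. [folklore] -/
theorem torsorDiscExpThree_eq_fifteen_of_law (h : TorsorDiscriminantLawThree)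
    (W : WeierstrassCurve ℚ) [W.IsElliptic] [W.IsGloballyMinimal] (hO5 : ClassO5 W 3) (ht : SubTprime W 3)
    (x : ℚ) (y : ℚ_[3]) (hP : IsKummerBasePointThree W (x : ℚ_[3]) y)
    [Fact (Irreducible (kummerNinePolyRat W x))] (hΔ : padicValRat 3 W.Δ ≠ 9) :
    torsorDiscExpThree W x = 15 := by
  have := h W hO5 ht x y hP
  rwa [if_neg hΔ] at this

/-! ## §3 The census record of kit j134597 (kernel data; `decide`d totals) -/

/-- The six strata of the P-K10-full score (`K10full-SCORE.txt` e88aea3a129ae34f): `S3*` = III (`v₃Δ = 3`),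
`S9*` = III* (`v₃Δ = 9`); `c01/c02/c11/c12` = the reducible-local line classes of KUM3LOC, `irr` = `LocIrr`.
[folklore] -/
inductive K10Stratum
  | S3c01 | S3c02 | S3irr | S9c11 | S9c12 | S9irr
  deriving DecidableEq, Repr

/-- One stratum of the record: count of computed rows, the observed `d3` (constant on the stratum), and the
splitting types `(e, f)` of the primes above `3` in the nonic field. [folklore] -/
structure K10Row where
  stratum : K10Stratum
  count : ℕ
  d3 : ℕ
  ef : List (ℕ × ℕ)
  deriving DecidableEq, Repr

/-- `v₃Δ_min` of the stratum's curves. [folklore] -/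
def K10Stratum.valDisc : K10Stratum → ℕ
  | .S3c01 | .S3c02 | .S3irr => 3
  | .S9c11 | .S9c12 | .S9irr => 9

/-- The law's prediction per stratum: `9` at `v₃Δ = 9`, `15` at `v₃Δ = 3`. [folklore] -/
def K10Stratum.predicted (s : K10Stratum) : ℕ := if s.valDisc = 9 then 9 else 15

/-- **The P-K10-full record** (kit j134597, rows 9922a189fcd14531; every computed row of a stratum had the
SAME `d3` and `(e,f)`, so one line per stratum is the whole table; 20 further III* class-11 rows were
`e_IRREDPOL`). EVIDENCE. [folklore] -/
def torsorDiscCensusK10 : List K10Row :=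
  [⟨.S3c01, 27224, 15, [(9, 1)]⟩, ⟨.S3c02, 25665, 15, [(9, 1)]⟩, ⟨.S3irr, 24526, 15, [(9, 1)]⟩,
   ⟨.S9c11, 25645, 9, [(3, 1), (3, 2)]⟩, ⟨.S9c12, 27224, 9, [(3, 3)]⟩, ⟨.S9irr, 24526, 9, [(9, 1)]⟩]

/-- `154 810` computed rows (`+ 20` refusals `= 154 830` O5b singles); III `77 415`, III* `77 395`. [folklore] -/
theorem torsorDiscCensusK10_total :
    (torsorDiscCensusK10.map (·.count)).sum = 154810 ∧
    ((torsorDiscCensusK10.filter fun r ↦ r.stratum.valDisc = 3).map (·.count)).sum = 77415 ∧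
    ((torsorDiscCensusK10.filter fun r ↦ r.stratum.valDisc = 9).map (·.count)).sum = 77395 := by
  decide

/-- **0 violations**: every stratum's observed `d3` is the law's prediction, and the local degrees
`Σ e·f = 9` account for the whole nonic algebra. [folklore] -/
theorem torsorDiscCensusK10_obeys :
    ∀ r ∈ torsorDiscCensusK10, r.d3 = r.stratum.predicted ∧ (r.ef.map fun ef ↦ ef.1 * ef.2).sum = 9 := by
  decide

/-! ## §4 AMENDMENT (cc-typer-5 GEN 8, A-O5-18 (b)): the I₀*-ss clause `d3 = 13` (P-K11) and the break table -/

/-- **The break calculus of v2 Thm 3** (o5-r1 GEN 6; CHECKED harvest-2 E90 R6): a Kummer base point of formal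
valuation `t` on the good model over `ℚ₃(3^{1/4})` gives the torsor field the single upper break `s = 9 − 8t`
over `L = ℚ₉(3^{1/8})` (from `i_{M/L}(g) = 72·(1/72 + 1/8 − t/9) = 10 − 8t` for every `g ≠ 1`).  Pure
arithmetic of the table; the derivation is the cell's (EVIDENCE / THEOREM-CANDIDATE), not asserted here. [folklore] -/
def torsorBreakThree (t : ℚ) : ℚ := 9 - 8 * t

/-- **The break table** `(t, s, d3 = s + 8)`: good-ss `t = 1 ↦ (1, 9)`, III `t = 1/4 ↦ (7, 15)`, I₀*-ss
`t = 1/2 ↦ (5, 13)`, III* `t = 3/4 ↦ s = 3` (below the flat bound, so the III* line is read on `ℓ₁*`, `d3 = 9`,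
T19 — not `3 + 8`). PROVED arithmetic. [folklore] -/
theorem torsorBreakThree_table :
    torsorBreakThree 1 = 1 ∧ torsorBreakThree 1 + 8 = 9 ∧
    torsorBreakThree (1 / 4) = 7 ∧ torsorBreakThree (1 / 4) + 8 = 15 ∧
    torsorBreakThree (1 / 2) = 5 ∧ torsorBreakThree (1 / 2) + 8 = 13 ∧
    torsorBreakThree (3 / 4) = 3 := by
  unfold torsorBreakThree; norm_num

/-- **P-K11 `TorsorDiscriminantLawIzeroStarThree` — the I₀*-ss clause (o5-r1 GEN 6, pre-registered P-K11 arm A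
BEFORE kit j135074, `gen6/P-K11-PREREG.md` 865ebe3113ad7574; PREDICTED value, never observed before the run;
EVIDENCE 0 violations / 9 744 + 750; derivation v2 Thm 3 at `t = 1/2` CHECKED by harvest-2 E90 R6 —
THEOREM-CANDIDATE; `@[conjecture]` tag until a kernel proof, lane rule ⟦gen23⟧ (8)(c)).**  For an O5a curve `W`
(`ClassO5 ∧ SubGss` at `3`: additive of Delbourgo type (G) with potentially SUPERSINGULAR reduction — Kodaira I₀*,
tame `e = 2`, the `χ₋₃`- or `χ₃`-twist of a good supersingular curve; `v₃(Δ_min) = 6`; `W[3]|G_{ℚ₃} ≅ V₀ ⊗ ω`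
irreducible automatically), a Kummer base point `(x, y)` with `x ∈ ℚ` (`IsKummerBasePointThree`) and `Λ_x`
irreducible over `ℚ`: the torsor discriminant exponent is **`d3 = 13`** (upper break `s = 5`: the Kummer line is
the conductor-5 line `ℓ₅*` of `H¹(ℚ₃, V₀ ⊗ ω)`, T21 `KummerLineUniversalIzeroStarThree`; `(e,f) = (9,1)`), on BOTH
sub-cells (`a₃` of the good twist `= 0` or `= ±3`).  Why it might fail: only through v2 Thm 3 at `t = 1/2`; one
I₀*-ss row with `d3 ≠ 13` refutes it (and kills T21).  Instrument: ONE engine family (PARI `nfdisc`; second code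
path harvest-2 j135711 6/6) — PROVISIONAL for consumers under the two-engine rule.
[evidence: census cell O5, o5-r1 GEN 6 P-K11: kit j135074 arm A 9 744/9 744 (O5a₀ 5 906 + O5a± 3 838) d3 = 13, (e,f) = (9,1); arms C0r 500/500 + C0x 250/250 random local I₀*-ss curves d3 = 13; 0 counter-verdicts; harvest-2 kit j135711 6/6]
[cite: Serre1979, Ch. IV §3 and Ch. XV §2] [cite: Fontaine1985, Thm. A] -/
@[conjecture] def TorsorDiscriminantLawIzeroStarThree : Prop :=
  ∀ (W : WeierstrassCurve ℚ) [W.IsElliptic] [W.IsGloballyMinimal], ClassO5 W 3 → SubGss W 3 →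
    ∀ (x : ℚ) (y : ℚ_[3]), IsKummerBasePointThree W (x : ℚ_[3]) y →
      ∀ [Fact (Irreducible (kummerNinePolyRat W x))], torsorDiscExpThree W x = 13

/-- Reading: on an I₀*-ss row the law gives the `ℓ₅*` value `d3 = 5 + 8`. [folklore] -/
theorem torsorDiscExpThree_eq_thirteen_of_law (h : TorsorDiscriminantLawIzeroStarThree)
    (W : WeierstrassCurve ℚ) [W.IsElliptic] [W.IsGloballyMinimal] (hO5 : ClassO5 W 3) (hs : SubGss W 3)
    (x : ℚ) (y : ℚ_[3]) (hP : IsKummerBasePointThree W (x : ℚ_[3]) y)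
    [Fact (Irreducible (kummerNinePolyRat W x))] :
    (torsorDiscExpThree W x : ℚ) = torsorBreakThree (1 / 2) + 8 := by
  rw [h W hO5 hs x y hP, torsorBreakThree_table.2.2.2.2.2.1]; norm_num

/-- The two P-K11 arm-A sub-cells: O5a₀ (`a₃` of the good twist `= 0`, census kind `I0a`) and O5a±
(`a₃ = ±3`, kind `I0b`). [folklore] -/
inductive K11Stratum
  | I0a | I0b
  deriving DecidableEq, Repr

/-- One stratum of the P-K11 arm-A record: count of computed rows, the observed `d3` (constant on the stratum),
and the splitting types `(e, f)` above `3` in the nonic field. [folklore] -/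
structure K11Row where
  stratum : K11Stratum
  count : ℕ
  d3 : ℕ
  ef : List (ℕ × ℕ)
  deriving DecidableEq, Repr

/-- **The P-K11 arm-A record** (kit j135074, rows `gen6/kum3loc11/outputs/k11_rows.txt` 6ab3c5131b0b2c1e, score
`SCORE-K11.txt`; every row of a stratum had the SAME `d3` and `(e,f)`). EVIDENCE. [folklore] -/
def torsorDiscCensusK11 : List K11Row :=
  [⟨.I0a, 5906, 13, [(9, 1)]⟩, ⟨.I0b, 3838, 13, [(9, 1)]⟩]

/-- `9 744` computed census I₀*-ss rows (`= 5 906 + 3 838`), every one with `d3 = 13 = torsorBreak(1/2) + 8` and a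
totally ramified nonic (`Σ e·f = 9·1`). [folklore] -/
theorem torsorDiscCensusK11_obeys :
    (torsorDiscCensusK11.map (·.count)).sum = 9744 ∧
    ∀ r ∈ torsorDiscCensusK11, r.d3 = 13 ∧ (r.ef.map fun ef ↦ ef.1 * ef.2).sum = 9 := by
  decide

end Summit.BirchSwinnertonDyer.Rank1Residual.O5

end
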